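import Mathlib
import Literature.Computability.QuantumComplexity.Forrelation
import Literature.Computability.QuantumComplexity.CubicForrelation
import Literature.Computability.QuantumComplexity.ForrelationDerivativeTables

/-!
# Sketch — first lemmas of the crux-idea cards for `CubicStability` (stmt-QuantumAdvantage-2202)

Planner scratch file (crux-ideate, round 1, ideator 2).  Each `def … : Prop` below is the
FIRST CHECKABLE STATEMENT of one idea card; nothing is proved here (no `sorry` either: the
statements are packaged as `Prop`s so that the file elaborates cleanly).
-/

noncomputable section

open Finset
open Literature.Computability.QuantumComplexity

namespace Summit.QuantumAdvantage.QuantumAdvantage.Cruxes.CubicStability.Sketch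

variable {n : ℕ}

/-- `±1` reading of a Boolean function. -/
def sgn (f : (Fin n → Bool) → Bool) : (Fin n → Bool) → ℝ := fun x => signOf (f x)

/-! ### Card `table-transpose-cocycle` -/

/-- Dickson plateau of the rows of the derivative Walsh table of a CUBIC function: every row
`u ↦ T_f(h,u) = W_{D_h f}(u)` is the spectrum of the quadratic `D_h f`, hence `{0, ±2^{(n+k)/2}}`
-valued for one `k = k_h` (the corank of the alternating form `T_f(h,·,·)`). -/
def DicksonRow : Prop :=
  ∀ (n : ℕ) (f : (Fin n → Bool) → Bool), IsDegLeFun 3 f → ∀ h : Fin n → Bool,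
    ∃ k : ℕ, ∀ u : Fin n → Bool,
      DerivativeWalsh.dwt (sgn f) h u = 0 ∨ (DerivativeWalsh.dwt (sgn f) h u) ^ 2 = 2 ^ (n + k)

/-- FIRST LEMMA of card `table-transpose-cocycle` (exact-case anchor, new): in an exactly
forrelated CUBIC pair the COLUMNS of the derivative table of `f` are flat in modulus on their
support — equivalently the corank `k_h(f)` is constant along the spectral support of every
derivative of `g` (transpose law `T_g = T_fᵀ` of the tree + Dickson rows for `g`). -/
def ColumnFlatOfExact : Prop :=
  ∀ (n : ℕ) (f g : (Fin n → Bool) → Bool), IsDegLeFun 3 f → IsDegLeFun 3 g →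
    forrelation f g = 1 → ∀ h h' u : Fin n → Bool,
      DerivativeWalsh.dwt (sgn f) h u ≠ 0 → DerivativeWalsh.dwt (sgn f) h' u ≠ 0 →
        (DerivativeWalsh.dwt (sgn f) h u) ^ 2 = (DerivativeWalsh.dwt (sgn f) h' u) ^ 2

/-- The approximate version the line must then prove (stated for the record; `36 %` of the
Frobenius mass of `T_f` sits on sign-coherent symmetric incidences when `Φ ≥ 3/5`):
`∑_{h,u} T_f(h,u) T_g(u,h) ≥ (9/25)·8ⁿ` — this much IS the tree identity
`two_pow_mul_forrelation_sq`; recorded here only to fix notation. -/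
def SquaredMass : Prop :=
  ∀ (n : ℕ) (f g : (Fin n → Bool) → Bool), (3 : ℝ) / 5 ≤ forrelation f g →
    (9 : ℝ) / 25 * 2 ^ (3 * n) ≤
      ∑ h : Fin n → Bool, ∑ u : Fin n → Bool,
        DerivativeWalsh.dwt (sgn f) h u * DerivativeWalsh.dwt (sgn g) u h

/-! ### Card `mm-fibre-profile` -/

/-- Boolean inner product `y'·z` over `𝔽₂`. -/
def bip {m : ℕ} (y' z : Fin m → Bool) : Bool :=
  decide ((univ.filter fun i : Fin m => y' i && z i).card % 2 = 1)

/-- Maiorana–McFarland-SHAPED function `b(y',y'') = y'·F(y'') + hh(y'')` on `m + m` variables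
for an ARBITRARY map `F` (not necessarily a permutation) — Dillon's flat form. -/
def mmShape {m : ℕ} (F : (Fin m → Bool) → (Fin m → Bool)) (hh : (Fin m → Bool) → Bool) :
    (Fin (m + m) → Bool) → Bool :=
  fun y => xor (bip (fun i => y (Fin.castAdd m i)) (F (fun j => y (Fin.natAdd m j))))
    (hh (fun j => y (Fin.natAdd m j)))

/-- Density of SINGLETON fibres of `F`. -/
def singletonDensity {m : ℕ} (F : (Fin m → Bool) → (Fin m → Bool)) : ℝ :=
  ((univ.filter fun x' : Fin m → Bool =>
      (univ.filter fun y'' : Fin m → Bool => F y'' = x').card = 1).card : ℝ) / 2 ^ m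

/-- FIRST LEMMA of card `mm-fibre-profile`: for an MM-shaped `b` the spectrum is the
character-twisted fibre count of `F`, whence `Φ(a,b) ≤ E|G_b| ≤ 1/2 + t/2` with `t` the
singleton-fibre density (uses `c(2) = 1`, `c(3) = 3/2`, `c(s) ≤ √s ≤ s/2` for `s ≥ 4`).
So a YES pair forces `t ≥ 1/5`. -/
def FibreBound : Prop :=
  ∀ (m : ℕ) (F : (Fin m → Bool) → (Fin m → Bool)) (hh : (Fin m → Bool) → Bool)
    (a : (Fin (m + m) → Bool) → Bool),
    forrelation a (mmShape F hh) ≤ 1 / 2 + singletonDensity F / 2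

/-- Companion (Cauchy–Schwarz across the cosets of the flat): NO bent function — cubic or not,
aligned or not — is within `2ⁿ/4` of an MM-shaped `b` unless `μ(F) = E_{x'} √|F⁻¹(x')| ≥ 1/2`;
stated through forrelation = 1 witnesses to stay inside existing vocabulary. -/
def FibreDistanceBound : Prop :=
  ∀ (m : ℕ) (F : (Fin m → Bool) → (Fin m → Bool)) (hh : (Fin m → Bool) → Bool)
    (f₀ g₀ : (Fin (m + m) → Bool) → Bool), forrelation f₀ g₀ = 1 →
    4 * (univ.filter fun y : Fin (m + m) → Bool => mmShape F hh y ≠ g₀ y).card ≤ 2 ^ (m + m) →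
      (1 : ℝ) / 2 ≤ (∑ x' : Fin m → Bool,
        Real.sqrt ((univ.filter fun y'' : Fin m → Bool => F y'' = x').card : ℝ)) / 2 ^ m

/-! ### Card `kt-pair-bentification` -/

/-- FIRST LEMMA of card `kt-pair-bentification` (one-sided distance law): against an EXACT pair
`(f₀,g₀)` the forrelation of `(f,g₀)` is affine in the Hamming distance `#{f ≠ f₀}`:
`Φ(f,g₀) = 1 − 2·#{f ≠ f₀}/2ⁿ`.  Hence `CubicStability` ⇔ every `3/5`-forrelated cubic pair is
CROSSWISE `1/2`-forrelated with some exactly forrelated cubic pair, and the unknown exact pair is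
`(f + e', g + e)` with `e, e'` in the explicit Kasami–Tokura(–Azumi) catalogue of `RM(3,n)`
words of weight `≤ 2^{n-2}`. -/
def OneSidedLaw : Prop :=
  ∀ (n : ℕ) (f f₀ g₀ : (Fin n → Bool) → Bool), forrelation f₀ g₀ = 1 →
    forrelation f g₀ =
      1 - 2 * ((univ.filter fun x : Fin n → Bool => f x ≠ f₀ x).card : ℝ) / 2 ^ n

/-- The reformulation it yields (equivalent to the crux, recorded for the line card). -/
def CrossHalves : Prop :=
  ∀ n : ℕ, Even n → ∀ f g : (Fin n → Bool) → Bool, IsDegLeFun 3 f → IsDegLeFun 3 g →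
    (3 : ℝ) / 5 ≤ forrelation f g →
      ∃ f₀ g₀ : (Fin n → Bool) → Bool, IsDegLeFun 3 f₀ ∧ IsDegLeFun 3 g₀ ∧
        forrelation f₀ g₀ = 1 ∧ (1 : ℝ) / 2 ≤ forrelation f g₀ ∧ (1 : ℝ) / 2 ≤ forrelation f₀ g

end Summit.QuantumAdvantage.QuantumAdvantage.Cruxes.CubicStability.Sketch
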